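import Summits.ResolutionOfSingularities.ResolutionOfSingularities.Theorems.HilbertSamuelEliminationCampaignW42HypersurfaceSectionEquality
import Summits.ResolutionOfSingularities.ResolutionOfSingularities.Theorems.HilbertSamuelEliminationCampaignW42RidgeDimMonotoneOfThm3104
import Literature.RingTheory.HilbertSamuel.HypersurfaceSection
import Literature.RingTheory.HilbertSamuel.TangentConeChangeOfGenerators
import Literature.RingTheory.HilbertSamuel.DirectrixQuasiEtale
import Literature.RingTheory.HilbertSamuel.RegularCriterion
import Literature.RingTheory.HilbertSamuel.FlatBaseChange
import Literature.RingTheory.HilbertSamuel.PhiLowerBound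
import HarnessLib

/-!
# [OURS · L1 W4.2] The equality case of a hypersurface section, continued: the RIDGE / DIRECTRIX dimensions drop by AT MOST
# ONE per section — `e(A)_K ≤ e(A/tA)_K + 1`, `dim F(A) ≤ dim F(A/tA) + 1`, and `dim F(A) ≤ dim F(A/(t_1..t_r)) + r` when
# `H⁽ʳ⁾(A/(t)) = H⁽⁰⁾(A)` (Dietel (4.6.5) (ii) + (6.4.6), (8.2.7.E); campaign s42, cell res-hironaka; informal crux
# `RidgeConfinement`, stmt-ResolutionOfSingularities-17845; `--supports`; brick B1' of the unconditional `RidgeDimMonotone`)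

HONEST FRAMING. OURS (slot W4.2, prover res-L1-s42-pv-1, gen 5). The tree proves (`HypersurfaceSection.lean`, CJS (3.14) first
inequality) that for a surjection of local rings `A → B` with kernel `tA`, `t ∈ 𝔪_A`, one has `H⁽⁰⁾(A) ≤ H⁽¹⁾(B)`. This file treats
the EQUALITY `H⁽¹⁾(B) = H⁽⁰⁾(A)` (Dietel's Prop. (4.6.5) (ii) = [H4, Prop. 6] = [Gi, I 3.9], the equality case of Bennett's
hypersurface-section lemma), which is what a NEAR point of a permissible blow-up produces at each of the `s + 1` sections cutting
`𝒪_{X',x'}` down to the fibre `𝒪_{π⁻¹(x),x'}` (Dietel (8.2.7.1)) and at each algebraic generator of a residue field extension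
(Dietel (8.2.3)):

* `mem_pow_of_mul_mem_pow_succ_of_hilbertSamuelFun_one_eq` — **`(𝔪ⁿ⁺¹ : t) = 𝔪ⁿ` for all `n`** (the length count behind the
  tree's inequality is an equality iff the kernel of `a ↦ ta : A/𝔪ⁿ → A/𝔪ⁿ⁺¹` vanishes); hence `t ∉ 𝔪²` and
  `emb.dim A = emb.dim B + 1` (`spanFinrank_eq_succ_of_hilbertSamuelFun_one_eq`);
* `tangentConeIdeal_eq_map_of_hilbertSamuelFun_one_eq` — **`gr(B) = gr(A)/in(t)`** in the tree's coordinates: for generators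
  `ȳ` of `𝔪_B` with lifts `y`, the family `z = (t, y)` generates `𝔪_A` and the tangent cone ideal `J_ȳ ⊆ k_B[Y_1..Y_e]` is the
  image of `J_z ⊆ k_A[X_0, X_1..X_e]` under `X_0 ↦ 0, X_{i+1} ↦ Y_i` (coefficients through `k_A ≅ k_B`);
* **`dirDimOver_le_dirDimOver_add_one_of_hilbertSamuelFun_one_eq`** — `e(A)_K ≤ e(B)_K + 1` for every common extension `K` of the
  residue fields; **`localRidgeDim_le_localRidgeDim_add_one_of_hilbertSamuelFun_one_eq`** — `dim F(A) ≤ dim F(B) + 1` (Giraud's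
  ridge; `dim F = e_K` at perfect `K`, tree); `geomDirDim_…`, `dirDim_…` likewise (Dietel (6.4.6) via
  `…CampaignW42DirectrixLinearSection`);
* the ITERATED form **`localRidgeDim_le_localRidgeDim_add_card_of_hilbertSamuelFun_eq`**: for a surjection with kernel
  `(t_1, …, t_r)` and `H⁽ʳ⁾(B) = H⁽⁰⁾(A)`, `dim F(A) ≤ dim F(B) + r` (all intermediate sections are then equalities).

NOTHING here is a statement of H. Hironaka's manuscript [Hironaka2017]. AI review is weaker than expert review.
References (orientation only): B. Dietel, Dissertation Regensburg (2015), Prop. (4.6.5) p. 58, Lemma (6.4.6) p. 81, (8.2.3),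
(8.2.7.1); H. Hironaka, J. Math. Kyoto Univ. 10 (1970), Prop. 6; J. Giraud, *Étude locale des singularités* (Orsay 1972) I 3.9;
V. Cossart, U. Jannsen, S. Saito, LNM 2270 (2020), proof of Thm. 3.10, (3.14).
-/

noncomputable section

-- single-conjunct summit: the doubled namespace component `ResolutionOfSingularities` is mandated
set_option linter.dupNamespace false

open IsLocalRing MvPolynomial Finset
open Literature.RingTheory.HilbertSamuel Literature.RingTheory.MvPolynomial
open Literature.AlgebraicGeometry.Resolution

namespace Summit.ResolutionOfSingularities.ResolutionOfSingularities.Theorems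

namespace CampaignW42

universe u v w

/-! ## Directrix and ridge dimensions drop by at most one -/

section Directrix

variable {A : Type u} {B : Type u} [CommRing A] [CommRing B] [IsLocalRing A] [IsLocalRing B] [IsNoetherianRing A]
  [IsNoetherianRing B] [Algebra A B] [IsLocalHom (algebraMap A B)] (hf : Function.Surjective (algebraMap A B)) {t : A}
  (hK : RingHom.ker (algebraMap A B) = Ideal.span {t}) (hH : hilbertSamuelFun B 1 = hilbertFun A)

include hf hK hH in
/-- **`e(A)_K ≤ e(B)_K + 1`** in the equality case `H⁽¹⁾(B) = H⁽⁰⁾(A)` of a hypersurface section `B = A/tA`, for every field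
`K` over both residue fields compatibly (`k_A → k_B → K`): `J_B · K[Y] = (J_A · K[X])|_{X_0 = 0}` by
`tangentConeIdeal_eq_map_of_hilbertSamuelFun_one_eq`, and restriction to a hyperplane costs at most one directrix dimension.
[cite: Dietel2015, Prop. (4.6.5) (ii) p. 58, Lemma (6.4.6) p. 81] -/
theorem dirDimOver_le_dirDimOver_add_one_of_hilbertSamuelFun_one_eq (K : Type w) [Field K]
    [Algebra (ResidueField A) K] [Algebra (ResidueField B) K]
    (hKc : (algebraMap (ResidueField B) K).comp (ResidueField.map (algebraMap A B)) = algebraMap (ResidueField A) K) :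
    dirDimOver A K ≤ dirDimOver B K + 1 := by
  classical
  -- lifts of the minimal generators of `𝔪_B`
  let y : Fin (maximalIdeal B).spanFinrank → A := fun i => (hf (minGenerators B i)).choose
  have hy : ∀ i, algebraMap A B (y i) = minGenerators B i := fun i => (hf (minGenerators B i)).choose_spec
  have hz := span_range_cons_eq_maximalIdeal hf hK (span_range_minGenerators B) hy
  have he := spanFinrank_eq_succ_of_hilbertSamuelFun_one_eq hf hH
  rw [dirDimOver_eq' A K he _ hz]
  unfold dirDimOver canonicalTangentConeIdeal
  rw [tangentConeIdeal_eq_map_of_hilbertSamuelFun_one_eq hf hK hH (span_range_minGenerators B) hy, Ideal.map_map]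
  set e := (maximalIdeal B).spanFinrank
  have hcomp : (MvPolynomial.map (algebraMap (ResidueField B) K)).comp
      (((aeval (Fin.cons 0 X : Fin (e + 1) → MvPolynomial (Fin e) (ResidueField B)) :
          MvPolynomial (Fin (e + 1)) (ResidueField B) →ₐ[ResidueField B] MvPolynomial (Fin e) (ResidueField B)) :
          MvPolynomial (Fin (e + 1)) (ResidueField B) →+* MvPolynomial (Fin e) (ResidueField B)).comp
        (MvPolynomial.map (ResidueField.map (algebraMap A B)))) =
      ((aeval (Fin.cons 0 X : Fin (e + 1) → MvPolynomial (Fin e) K) :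
          MvPolynomial (Fin (e + 1)) K →ₐ[K] MvPolynomial (Fin e) K) :
          MvPolynomial (Fin (e + 1)) K →+* MvPolynomial (Fin e) K).comp
        (MvPolynomial.map (algebraMap (ResidueField A) K)) := by
    rw [← RingHom.comp_assoc, map_comp_killFirst, RingHom.comp_assoc]
    congr 1
    exact RingHom.ext fun p => by rw [RingHom.comp_apply, MvPolynomial.map_map, hKc]
  rw [hcomp, ← Ideal.map_map]
  exact directrixDim_le_directrixDim_map_killFirst_add_one _

include hf hK hH in
/-- **`dim F(A) ≤ dim F(B) + 1`** (Giraud's ridge) in the equality case of a hypersurface section — Dietel's (8.2.7.E) one section at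
a time; `dim F = e_K` for the perfect field `K = k_B^{alg}`. [cite: Dietel2015, Prop. (4.6.5) (ii), Lemma (6.4.6), (8.2.7.E) p. 106] -/
theorem localRidgeDim_le_localRidgeDim_add_one_of_hilbertSamuelFun_one_eq : localRidgeDim A ≤ localRidgeDim B + 1 := by
  let K := AlgebraicClosure (ResidueField B)
  letI : Algebra (ResidueField A) K := ((algebraMap (ResidueField B) K).comp (ResidueField.map (algebraMap A B))).toAlgebra
  rw [localRidgeDim_eq_dirDimOver_of_perfectField A K, localRidgeDim_eq_dirDimOver_of_perfectField B K]
  exact dirDimOver_le_dirDimOver_add_one_of_hilbertSamuelFun_one_eq hf hK hH K rfl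

include hf hK hH in
/-- **`ē(A) ≤ ē(B) + 1`** in the equality case of a hypersurface section (`ē = dim F`). [cite: Dietel2015, Prop. (4.6.5) (ii), Lemma (6.4.6)] -/
theorem geomDirDim_le_geomDirDim_add_one_of_hilbertSamuelFun_one_eq : geomDirDim A ≤ geomDirDim B + 1 := by
  have hA : geomDirDim A = localRidgeDim A := (localRidgeDim_eq_dirDimOver_of_perfectField A _).symm
  have hB : geomDirDim B = localRidgeDim B := (localRidgeDim_eq_dirDimOver_of_perfectField B _).symm
  rw [hA, hB]
  exact localRidgeDim_le_localRidgeDim_add_one_of_hilbertSamuelFun_one_eq hf hK hH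

include hf hK hH in
/-- **`e(A) ≤ e(B) + 1`** in the equality case of a hypersurface section (residue fields identified along `f`).
[cite: Dietel2015, Prop. (4.6.5) (ii), Lemma (6.4.6)] -/
theorem dirDim_le_dirDim_add_one_of_hilbertSamuelFun_one_eq : dirDim A ≤ dirDim B + 1 := by
  letI : Algebra (ResidueField A) (ResidueField B) := (ResidueField.map (algebraMap A B)).toAlgebra
  have h := dirDimOver_le_dirDimOver_add_one_of_hilbertSamuelFun_one_eq hf hK hH (ResidueField B)
    (RingHom.ext fun _ => rfl)
  rw [dirDimOver_residueField] at h
  -- `k_A → k_B` is an isomorphism, so `e(A)_{k_B} = e(A)`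
  have hbij : Function.Bijective (ResidueField.map (algebraMap A B)) := by
    refine ⟨(ResidueField.map (algebraMap A B)).injective, fun b => ?_⟩
    obtain ⟨b', rfl⟩ := residue_surjective b
    obtain ⟨a, rfl⟩ := hf b'
    exact ⟨residue A a, rfl⟩
  have hA : dirDimOver A (ResidueField B) = dirDim A := by
    rw [dirDimOver, dirDim]
    exact directrixDim_map_eq_of_bijective _ hbij _
  rwa [hA] at h

end Directrix

/-! ## Several sections: `H⁽ʳ⁾(A/(t_1, …, t_r)) = H⁽⁰⁾(A) ⟹ dim F(A) ≤ dim F(A/(t)) + r` -/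

section Iterated

/-- Ridge dimension is invariant under surjections with zero kernel (isomorphisms of local rings). [folklore] -/
theorem localRidgeDim_eq_of_ker_eq_bot {A : Type u} {B : Type u} [CommRing A] [CommRing B] [IsLocalRing A] [IsLocalRing B]
    [IsNoetherianRing A] [IsNoetherianRing B] [Algebra A B] (hf : Function.Surjective (algebraMap A B))
    (hK : RingHom.ker (algebraMap A B) = ⊥) : localRidgeDim A = localRidgeDim B := by
  let e : A ≃+* B := RingEquiv.ofBijective (algebraMap A B) ⟨(RingHom.injective_iff_ker_eq_bot _).mpr hK, hf⟩
  have hA : geomDirDim A = localRidgeDim A := (localRidgeDim_eq_dirDimOver_of_perfectField A _).symm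
  have hB : geomDirDim B = localRidgeDim B := (localRidgeDim_eq_dirDimOver_of_perfectField B _).symm
  rw [← hA, ← hB]
  exact (geomDirDim_eq_of_ringEquiv e).symm

/-- Pointwise squeeze for chains of Hilbert functions: `a ≤ b ≤ c ≤ a ⟹ a = b ∧ b = c`. [folklore] -/
private theorem eq_of_le_chain {a b c : ℕ → ℕ} (h1 : a ≤ b) (h2 : b ≤ c) (h3 : c ≤ a) : a = b ∧ b = c :=
  ⟨le_antisymm h1 (h2.trans h3), le_antisymm h2 (h3.trans h1)⟩

/-- Induction on the number of generators, through `A → A/t₁A → B`: every section on the way is an equality case.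
[cite: Dietel2015, (8.2.7.1) p. 105–106] -/
private theorem localRidgeDim_le_of_card_le (r : ℕ) :
    ∀ {A : Type u} {B : Type u} [CommRing A] [CommRing B] [IsLocalRing A] [IsLocalRing B] [IsNoetherianRing A]
      [IsNoetherianRing B] [Algebra A B], Function.Surjective (algebraMap A B) →
      ∀ s : Finset A, s.card ≤ r → RingHom.ker (algebraMap A B) = Ideal.span (s : Set A) →
        hilbertSamuelFun B s.card = hilbertFun A → localRidgeDim A ≤ localRidgeDim B + s.card := by
  induction r with
  | zero =>
    intro A B _ _ _ _ _ _ _ hf s hs hK _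
    have hs0 : s = ∅ := Finset.card_eq_zero.mp (Nat.le_zero.mp hs)
    subst hs0
    rw [Finset.coe_empty, Ideal.span_empty] at hK
    rw [Finset.card_empty, add_zero, localRidgeDim_eq_of_ker_eq_bot hf hK]
  | succ r ih =>
    intro A B _ _ _ _ _ _ _ hf s hs hK hH
    classical
    by_cases hs0 : s = ∅
    · subst hs0
      rw [Finset.coe_empty, Ideal.span_empty] at hK
      rw [Finset.card_empty, add_zero, localRidgeDim_eq_of_ker_eq_bot hf hK]
    obtain ⟨a, ha⟩ := Finset.nonempty_iff_ne_empty.mpr hs0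
    haveI : IsNoetherianRing (A ⧸ Ideal.span {a}) :=
      isNoetherianRing_of_surjective_algebraMap (A := A) (B := A ⧸ Ideal.span {a}) Ideal.Quotient.mk_surjective
    have haK : a ∈ RingHom.ker (algebraMap A B) := by rw [hK]; exact Ideal.subset_span (Finset.mem_coe.mpr ha)
    have haM : a ∈ maximalIdeal A := IsLocalRing.le_maximalIdeal (RingHom.ker_ne_top _) haK
    have hle : Ideal.span {a} ≤ RingHom.ker (algebraMap A B) := (Ideal.span_singleton_le_iff_mem _).mpr haK
    have hne : Ideal.span {a} ≠ ⊤ := fun h => RingHom.ker_ne_top (algebraMap A B) (top_le_iff.mp (h ▸ hle))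
    haveI : Nontrivial (A ⧸ Ideal.span {a}) := Ideal.Quotient.nontrivial_iff.mpr hne
    haveI : IsLocalRing (A ⧸ Ideal.span {a}) := IsLocalRing.of_surjective' _ Ideal.Quotient.mk_surjective
    -- the remaining surjection `A/aA → B`
    let g : A ⧸ Ideal.span {a} →+* B := Ideal.Quotient.lift (Ideal.span {a}) (algebraMap A B) hle
    letI : Algebra (A ⧸ Ideal.span {a}) B := g.toAlgebra
    have hg : Function.Surjective (algebraMap (A ⧸ Ideal.span {a}) B) := by
      intro b
      obtain ⟨x, rfl⟩ := hf b
      exact ⟨Ideal.Quotient.mk _ x, Ideal.Quotient.lift_mk _ _ _⟩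
    set s' : Finset (A ⧸ Ideal.span {a}) := (s.erase a).image (Ideal.Quotient.mk (Ideal.span {a})) with hs'_def
    have hs'le : s'.card + 1 ≤ s.card := by
      have h1 : s'.card ≤ (s.erase a).card := Finset.card_image_le
      rw [Finset.card_erase_of_mem ha] at h1
      have h2 := Finset.card_pos.mpr ⟨a, ha⟩
      omega
    have hs' : s'.card ≤ r := by omega
    have hs_eq : (s : Set A) = insert a ((s.erase a : Finset A) : Set A) := by
      rw [← Finset.coe_insert, Finset.insert_erase ha]
    have hK' : RingHom.ker (algebraMap (A ⧸ Ideal.span {a}) B) = Ideal.span (s' : Set _) := by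
      change RingHom.ker g = _
      rw [Ideal.ker_quotient_lift _ hle, hK, Ideal.map_span, hs_eq, Set.image_insert_eq,
        Ideal.Quotient.eq_zero_iff_mem.mpr (Ideal.mem_span_singleton_self a), hs'_def, Finset.coe_image]
      exact Submodule.span_insert_zero
    have hKa : RingHom.ker (algebraMap A (A ⧸ Ideal.span {a})) = Ideal.span {a} := by
      rw [Ideal.Quotient.algebraMap_eq, Ideal.mk_ker]
    -- the chain `H(A) ≤ H⁽¹⁾(A/aA) ≤ H⁽¹⁺|s'|⁾(B) ≤ H⁽|s|⁾(B) = H(A)`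
    have h1 : hilbertFun A ≤ hilbertSamuelFun (A ⧸ Ideal.span {a}) 1 :=
      hilbertFun_le_hilbertSamuelFun_one_of_ker_le (A := A) (B := A ⧸ Ideal.span {a}) Ideal.Quotient.mk_surjective haM hKa.le
    have h2 : hilbertSamuelFun (A ⧸ Ideal.span {a}) 1 ≤ hilbertSamuelFun B (1 + s'.card) :=
      hilbertSamuelFun_le_of_ker_eq_span hg s' hK' 1
    have h3 : hilbertSamuelFun B (1 + s'.card) ≤ hilbertFun A := by
      rw [← hH]
      exact iterPSum_mono_left (hilbertFun B) (by omega)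
    obtain ⟨hE1, hE2⟩ := eq_of_le_chain h1 h2 h3
    -- one section: `dim F(A) ≤ dim F(A/aA) + 1`
    have hstep : localRidgeDim A ≤ localRidgeDim (A ⧸ Ideal.span {a}) + 1 := by
      haveI : IsLocalHom (algebraMap A (A ⧸ Ideal.span {a})) :=
        isLocalHom_of_map_maximalIdeal_eq
          (Literature.RingTheory.HilbertSamuel.map_maximalIdeal_eq_of_surjective Ideal.Quotient.mk_surjective)
      exact localRidgeDim_le_localRidgeDim_add_one_of_hilbertSamuelFun_one_eq (A := A) (B := A ⧸ Ideal.span {a})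
        Ideal.Quotient.mk_surjective hKa hE1.symm
    -- the rest: `H⁽|s'|⁾(B) = H⁽⁰⁾(A/aA)` and induction
    have hH' : hilbertSamuelFun B s'.card = hilbertFun (A ⧸ Ideal.span {a}) := by
      have h := hE2.symm
      rw [← iterPSum_hilbertSamuelFun B 1 s'.card] at h
      change iterPSum 1 (hilbertSamuelFun B s'.card) = iterPSum 1 (hilbertFun (A ⧸ Ideal.span {a})) at h
      exact iterPSum_injective 1 h
    have hrest := ih hg s' hs' hK' hH'
    omega

/-- **`dim F(A) ≤ dim F(B) + r` when `ker(A → B) = (t_1, …, t_r)` (`r = |s|`) and `H⁽ʳ⁾(B) = H⁽⁰⁾(A)`** — the iterated equality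
case: all `r` sections are then equality cases (the tree's inequalities `H⁽ⁱ⁾ ≤ H⁽ⁱ⁺¹⁾` along `A → A/t₁ → ⋯ → B` squeeze), and
each costs at most one ridge dimension. Dietel's (8.2.7.E) `R_{X',x'} ≤ R_{π⁻¹(x),x'} + (q + 1)` is the case of the `q + 1`
sections cutting `𝒪_{X',x'}` down to the fibre. [cite: Dietel2015, (8.2.7.1)–(8.2.7.E) p. 105–106] -/
theorem localRidgeDim_le_localRidgeDim_add_card_of_hilbertSamuelFun_eq {A : Type u} {B : Type u} [CommRing A] [CommRing B]
    [IsLocalRing A] [IsLocalRing B] [IsNoetherianRing A] [IsNoetherianRing B] [Algebra A B] (hf : Function.Surjective (algebraMap A B))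
    (s : Finset A) (hK : RingHom.ker (algebraMap A B) = Ideal.span (s : Set A))
    (hH : hilbertSamuelFun B s.card = hilbertFun A) : localRidgeDim A ≤ localRidgeDim B + s.card :=
  localRidgeDim_le_of_card_le s.card hf s le_rfl hK hH

/-- **`dim F(A) ≤ dim F(B) + r` for a family `t : Fin r → A` generating the kernel with `H⁽ʳ⁾(B) = H⁽⁰⁾(A)`.**
[cite: Dietel2015, (8.2.7.1)–(8.2.7.E) p. 105–106] -/
theorem localRidgeDim_le_localRidgeDim_add_of_hilbertSamuelFun_eq {A : Type u} {B : Type u} [CommRing A] [CommRing B]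
    [IsLocalRing A] [IsLocalRing B] [IsNoetherianRing A] [IsNoetherianRing B] [Algebra A B] (hf : Function.Surjective (algebraMap A B))
    {r : ℕ} (t : Fin r → A) (hK : RingHom.ker (algebraMap A B) = Ideal.span (Set.range t))
    (hH : hilbertSamuelFun B r = hilbertFun A) : localRidgeDim A ≤ localRidgeDim B + r := by
  classical
  have hcoe : ((Finset.univ.image t : Finset A) : Set A) = Set.range t := by
    rw [Finset.coe_image, Finset.coe_univ, Set.image_univ]
  have hcard : (Finset.univ.image t).card ≤ r :=
    Finset.card_image_le.trans (by rw [Finset.card_univ, Fintype.card_fin])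
  -- `H⁽⁰⁾(A) ≤ H⁽|s|⁾(B) ≤ H⁽ʳ⁾(B) = H⁽⁰⁾(A)`
  have h1 : hilbertFun A ≤ hilbertSamuelFun B (Finset.univ.image t).card := by
    have := hilbertSamuelFun_le_of_ker_eq_span hf (Finset.univ.image t) (hcoe ▸ hK) 0
    rwa [zero_add] at this
  have h2 : hilbertSamuelFun B (Finset.univ.image t).card ≤ hilbertSamuelFun B r := iterPSum_mono_left (hilbertFun B) hcard
  have hH' : hilbertSamuelFun B (Finset.univ.image t).card = hilbertFun A := le_antisymm (hH ▸ h2) h1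
  exact (localRidgeDim_le_localRidgeDim_add_card_of_hilbertSamuelFun_eq hf _ (hcoe ▸ hK) hH').trans (by omega)

end Iterated

end CampaignW42

end Summit.ResolutionOfSingularities.ResolutionOfSingularities.Theorems

end
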